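import Literature.NumberTheory.EllipticCurves.ModularDegreeFormulaDomainProofs
import Literature.NumberTheory.EllipticCurves.HeckeOperatorsProofs
import HarnessLib

/-!
# Rankin–Selberg unfolding on `Γ₀(N)` (measure-theoretic form)

Topic `Literature/NumberTheory/EllipticCurves`; theorems only (no definition, no named fact). Second
brick, after `NewformPeterssonSizeProofs.lean`, of the printed proof behind the named fact
`murty_petersson_newform_lower_bound` (`NewformPeterssonSize.lean`; M. R. Murty, *Bounds for
congruence primes* (1999), §2: `(f, f)_{Γ₀(N)} = N^{1+o(1)} L(1, sym² f)` by **Rankin–Selberg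
unfolding**, then Hoffstein–Lockhart). This file proves the unfolding step on the tree's
fundamental domain `F = ⋃_q g_q⁻¹ 𝒟ᵒ` of `Γ₀(N)` (`ModularDegreeFormulaDomainProofs.lean`:
`g : 𝒮ℒ/Γ₀(N) → SL(2, ℤ)` a system of coset representatives; `(f, f)_{Γ₀(N)} = ∫⁻_F |f|² y² dμ` by
`peterssonProduct_self_eq_lintegral`, `lintegral_fd_sum_eq_lintegral_domain`), entirely in `ℝ≥0∞`
(no convergence hypotheses): for every measurable `Γ₀(N)`-invariant `Φ ≥ 0` on `ℍ` and every
measurable `w : ℝ → ℝ≥0∞`,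

  `∫⁻_F Φ(τ) · Σ_{(c,d)=1, N∣c} w(Im τ / |cτ + d|²) dμ(τ) = 2 ∫⁻_{0 ≤ Re ρ < 1} Φ(ρ) w(Im ρ) dμ(ρ)`

(`lintegral_domain_mul_eisenstein_eq`), i.e. with `w(y) = yˢ` and the Eisenstein series of the
cusp `∞` of `Γ₀(N)`, `E_∞(τ, s) = Σ_{γ ∈ Γ_∞\Γ₀(N)} (Im γτ)ˢ = ½ Σ_{(c,d)=1, N∣c} yˢ/|cτ+d|^{2s}`,
the classical `∫_{Γ₀(N)\ℍ} Φ E_∞(·, s) dμ = ∫₀^∞ ∫₀¹ Φ yˢ dx dy/y²` (Rankin 1939; Selberg 1940;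
Iwaniec, *Spectral methods*, §3.2 (3.11) and the unfolding (3.13); Diamond–Shurman §5.4 for the
domain). The factor `2` is `±(c, d)`.

## Proof (as printed, "unfolding")

* `exists_sl2_row`, `exists_rowSection`: a coprime row `(c, d)` is the bottom row of some
  `γ_{(c,d)} ∈ SL(2, ℤ)`, in `Γ₀(N)` when `N ∣ c` (`rowSection_mem`).
* `bijective_T_zpow_mul_rowSection`: `(n, (c, d)) ↦ Tⁿ γ_{(c,d)}` is a bijection
  `ℤ × {(c,d) = 1, N ∣ c} → Γ₀(N)` (`Γ_∞ = {Tⁿ}` acts simply transitively on the matrices with a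
  given bottom row: `eq_T_zpow_of_apply_one`).
* `tsum_indicator_domain_smul_ae`: almost every `ρ ∈ ℍ` has exactly two `Γ₀(N)`-translates in `F`
  (`±γ₀`; Serre's `ModularGroup.eq_one_or_neg_one_of_mem_fdo_mem_fdo` through the tree's
  `exists_smul_mem_smul_fdo`, `eq_of_smul_eq_of_mem_fdo`, off the null set
  `volume_setOf_exists_smul_mem_fd_diff_fdo`).
* `lintegral_domain_mul_tsum_eq`: Tonelli; the substitution `σ = γ_v τ` (invariance of `dμ`,
  Mathlib `SMulInvariantMeasure (GL (Fin 2) ℝ) ℍ volume`, and of `Φ`); the partition of `ℍ` into the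
  strips `Tⁿ{0 ≤ Re < 1}` (`iUnion_strip_eq_univ`, `pairwise_disjoint_strip`,
  `preimage_T_zpow_strip`) moved back by `T⁻ⁿ` (invariance of `Φ`, `w ∘ Im`); re-indexing the double
  sum over `(v, n)` as a sum over `δ ∈ Γ₀(N)` by the bijection; and the a.e. count `2`.

What is NOT here: the evaluation of the right-hand side for `Φ = |f|² yᵏ` (Parseval on horizontal
lines and the `Γ`-integral, giving `Γ(s+k-1)(4π)^{1-s-k} Σ |aₙ|² n^{1-s-k}`), and the analytic
continuation / residue of `E_∞(τ, s)` at `s = 1` — the next bricks.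

## References

* R. A. Rankin, *Contributions to the theory of Ramanujan's function τ(n) and similar arithmetical
  functions I, II*, Proc. Cambridge Philos. Soc. 35 (1939), 351–372.
* A. Selberg, *Bemerkungen über eine Dirichletsche Reihe, die mit der Theorie der Modulformen nahe
  verbunden ist*, Arch. Math. Naturvid. 43 (1940), 47–50.
* [Iwaniec2002] H. Iwaniec, *Spectral Methods of Automorphic Forms*, 2nd ed., GSM 53, AMS 2002,
  §2.3 (cusps, `Γ_∞ = {±Tⁿ}`), §3.2 (3.11), (3.13) (unfolding against the Eisenstein series).
* [DiamondShurman2005] F. Diamond, J. Shurman, *A First Course in Modular Forms*, GTM 228, §5.4.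
* [Murty1999CongruencePrimes] M. R. Murty, *Bounds for congruence primes* (1999), §2.
-/

noncomputable section

open scoped MatrixGroups ModularForm Modular ENNReal NNReal Function
open MeasureTheory Set Filter ModularGroup CongruenceSubgroup
open UpperHalfPlane hiding I

namespace Literature.NumberTheory.EllipticCurves.ModularForms


/-! ### Bottom rows: `Γ₀(N) ↔ ℤ × {(c, d) = 1, N ∣ c}` -/

section BottomRows

variable (N : ℕ)

/-- A coprime pair `(c, d)` is the bottom row of a matrix of `SL(2, ℤ)` (`uc + wd = 1` gives
`(w, -u; c, d)`; Diamond–Shurman, proof of Lemma 3.8.? / Iwaniec §2.3). [folklore] -/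
theorem exists_sl2_row (v : Fin 2 → ℤ) (hv : IsCoprime (v 0) (v 1)) :
    ∃ γ : SL(2, ℤ), γ 1 0 = v 0 ∧ γ 1 1 = v 1 := by
  obtain ⟨u, w, h⟩ := hv
  refine ⟨⟨!![w, -u; v 0, v 1], ?_⟩, rfl, rfl⟩
  rw [Matrix.det_fin_two_of]
  linear_combination h

/-- A section of the bottom-row map on the index set `{(c, d) : (c, d) = 1, N ∣ c}` of the
Eisenstein series of the cusp `∞` of `Γ₀(N)`: matrices `γ_v ∈ SL(2, ℤ)` with bottom row `v`. [folklore] -/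
theorem exists_rowSection :
    ∃ γ : {v : Fin 2 → ℤ // IsCoprime (v 0) (v 1) ∧ (N : ℤ) ∣ v 0} → SL(2, ℤ),
      ∀ v, (γ v) 1 0 = v.1 0 ∧ (γ v) 1 1 = v.1 1 := by
  choose γ h using fun v : {v : Fin 2 → ℤ // IsCoprime (v 0) (v 1) ∧ (N : ℤ) ∣ v 0} ↦
    exists_sl2_row v.1 v.2.1
  exact ⟨γ, h⟩

/-- Left multiplication by `Tⁿ = (1 n; 0 1)` does not change the bottom row. [folklore] -/
theorem T_zpow_mul_apply_one (n : ℤ) (M : SL(2, ℤ)) (j : Fin 2) : (T ^ n * M) 1 j = M 1 j := by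
  rw [Matrix.SpecialLinearGroup.coe_mul, ModularGroup.coe_T_zpow, Matrix.mul_apply, Fin.sum_univ_two]
  simp

/-- An element of `SL(2, ℤ)` with bottom row `(0, 1)` is `Tᵇ`, `b` its upper-right entry
(`Γ_∞⁺ = {Tⁿ}`; Iwaniec §2.3). [folklore] -/
theorem eq_T_zpow_of_apply_one (g : SL(2, ℤ)) (h0 : g 1 0 = 0) (h1 : g 1 1 = 1) :
    g = T ^ (g 0 1) := by
  have had := g.det_coe
  rw [Matrix.det_fin_two, h0, h1, mul_one, mul_zero, sub_zero] at had
  ext i j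
  fin_cases i <;> fin_cases j <;>
    simp [had, h0, h1, ModularGroup.coe_T_zpow]

variable {N}
variable (γ : {v : Fin 2 → ℤ // IsCoprime (v 0) (v 1) ∧ (N : ℤ) ∣ v 0} → SL(2, ℤ))
  (hγ : ∀ v, (γ v) 1 0 = v.1 0 ∧ (γ v) 1 1 = v.1 1)

include hγ in
/-- `γ_v ∈ Γ₀(N)` for a row `v = (c, d)` with `N ∣ c`. [folklore] -/
theorem rowSection_mem [NeZero N] (v : {v : Fin 2 → ℤ // IsCoprime (v 0) (v 1) ∧ (N : ℤ) ∣ v 0}) :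
    γ v ∈ Gamma0 N := by
  rw [Gamma0_mem, (hγ v).1, ZMod.intCast_zmod_eq_zero_iff_dvd]
  exact v.2.2

include hγ in
/-- **`Γ₀(N) = ⨆_{(c,d)=1, N∣c} Γ_∞⁺ γ_{(c,d)}`**: the map `(n, v) ↦ Tⁿ γ_v` is a bijection from
`ℤ × {(c, d) = 1, N ∣ c}` onto `Γ₀(N)` (injective: the bottom row recovers `v`, then `Tⁿ = Tᵐ`
forces `n = m`; surjective: `γ γ_v⁻¹` has bottom row `(0, 1)` for `v` the bottom row of `γ`,
hence is some `Tⁿ`). This is the indexation `Γ_∞\Γ₀(N) ↔ {±(c, d)}` of the Eisenstein series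
(Iwaniec §2.3, §3.2). [folklore] -/
theorem bijective_T_zpow_mul_rowSection [NeZero N] :
    Function.Bijective (fun p : ℤ × {v : Fin 2 → ℤ // IsCoprime (v 0) (v 1) ∧ (N : ℤ) ∣ v 0} ↦
      (⟨T ^ p.1 * γ p.2, mul_mem (T_zpow_mem_Gamma0 N p.1) (rowSection_mem γ hγ p.2)⟩ : Gamma0 N)) := by
  constructor
  · rintro ⟨n, v⟩ ⟨m, w⟩ h
    simp only [Subtype.mk.injEq] at h
    have hvw : v = w := by
      have h0 := congrArg (fun g : SL(2, ℤ) ↦ g 1 0) h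
      have h1 := congrArg (fun g : SL(2, ℤ) ↦ g 1 1) h
      simp only [T_zpow_mul_apply_one, (hγ v).1, (hγ v).2, (hγ w).1, (hγ w).2] at h0 h1
      apply Subtype.ext
      ext i
      fin_cases i
      · exact h0
      · exact h1
    subst hvw
    have hT : T ^ n = T ^ m := mul_right_cancel h
    have h01 := congrArg (fun g : SL(2, ℤ) ↦ g 0 1) hT
    simp only [ModularGroup.coe_T_zpow, Matrix.of_apply, Matrix.cons_val', Matrix.cons_val_one,
      Matrix.cons_val_fin_one, Matrix.cons_val_zero] at h01
    simp [h01]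
  · rintro ⟨g, hg⟩
    have hc : IsCoprime (g 1 0) (g 1 1) := by
      refine ⟨-(g 0 1), g 0 0, ?_⟩
      have := g.det_coe
      rw [Matrix.det_fin_two] at this
      linear_combination this
    have hN : (N : ℤ) ∣ g 1 0 := by
      rw [Gamma0_mem] at hg
      exact (ZMod.intCast_zmod_eq_zero_iff_dvd _ _).mp hg
    let v : {v : Fin 2 → ℤ // IsCoprime (v 0) (v 1) ∧ (N : ℤ) ∣ v 0} :=
      ⟨![g 1 0, g 1 1], by simpa using hc, by simpa using hN⟩
    set h : SL(2, ℤ) := g * (γ v)⁻¹ with hh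
    have hv0 : (γ v) 1 0 = g 1 0 := by rw [(hγ v).1]; rfl
    have hv1 : (γ v) 1 1 = g 1 1 := by rw [(hγ v).2]; rfl
    have h10 : h 1 0 = 0 := by
      rw [hh, Matrix.SpecialLinearGroup.coe_mul, Matrix.SpecialLinearGroup.coe_inv,
        Matrix.adjugate_fin_two, Matrix.mul_apply, Fin.sum_univ_two]
      simp [hv0, hv1]
      ring
    have h11 : h 1 1 = 1 := by
      have hdet := (γ v).det_coe
      rw [Matrix.det_fin_two] at hdet
      rw [hh, Matrix.SpecialLinearGroup.coe_mul, Matrix.SpecialLinearGroup.coe_inv,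
        Matrix.adjugate_fin_two, Matrix.mul_apply, Fin.sum_univ_two]
      simp only [Matrix.of_apply, Matrix.cons_val', Matrix.cons_val_one, Matrix.cons_val_fin_one,
        Matrix.cons_val_zero]
      rw [← hv0, ← hv1]
      linear_combination hdet
    refine ⟨(h 0 1, v), ?_⟩
    simp only [Subtype.mk.injEq]
    rw [← eq_T_zpow_of_apply_one h h10 h11, hh, inv_mul_cancel_right]

end BottomRows

/-! ### `F` is a fundamental domain for `Γ₀(N)/{±1}`: the almost-everywhere count -/

section Count

variable {N : ℕ}
variable (g : (↥𝒮ℒ ⧸ (Gamma0 N : Subgroup (GL (Fin 2) ℝ)).subgroupOf 𝒮ℒ) → SL(2, ℤ))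
  (hg : ∀ q, (Matrix.SpecialLinearGroup.mapGL ℝ (g q) : GL (Fin 2) ℝ) = ((q.out : ↥𝒮ℒ) : GL (Fin 2) ℝ))

include hg in
/-- If two `Γ₀(N)`-translates `γ₀ ρ`, `δ ρ` of a point both lie in the domain `F = ⋃_q g_q⁻¹ 𝒟ᵒ`
then `δ = ±γ₀` (the two points coincide by `eq_of_smul_eq_of_mem_fdo`, and an element of `Γ₀(N)`
fixing a point of `g_q⁻¹ 𝒟ᵒ` is `±1` by Serre's theorem
`ModularGroup.eq_one_or_neg_one_of_mem_fdo_mem_fdo`). [folklore] -/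
theorem eq_or_eq_neg_of_smul_mem_domain {ρ : ℍ} {γ₀ δ : SL(2, ℤ)} (hγ₀ : γ₀ ∈ Gamma0 N)
    (hδ : δ ∈ Gamma0 N) (h₀ : γ₀ • ρ ∈ ⋃ q, {τ : ℍ | g q • τ ∈ 𝒟ᵒ})
    (h₁ : δ • ρ ∈ ⋃ q, {τ : ℍ | g q • τ ∈ 𝒟ᵒ}) : δ = γ₀ ∨ δ = -γ₀ := by
  simp only [mem_iUnion, mem_setOf_eq] at h₀ h₁
  obtain ⟨q, hq⟩ := h₀
  obtain ⟨r, hr⟩ := h₁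
  have hmem : δ * γ₀⁻¹ ∈ Gamma0 N := (Gamma0 N).mul_mem hδ ((Gamma0 N).inv_mem hγ₀)
  have heq : γ₀ • ρ = δ • ρ :=
    eq_of_smul_eq_of_mem_fdo g hg hq hr hmem (by rw [mul_smul, inv_smul_smul])
  have hmove : (g q * (δ * γ₀⁻¹) * (g q)⁻¹) • (g q • γ₀ • ρ) ∈ 𝒟ᵒ := by
    rw [mul_smul, inv_smul_smul, mul_smul, mul_smul, inv_smul_smul, ← heq]
    exact hq
  rcases eq_one_or_neg_one_of_mem_fdo_mem_fdo hq hmove with h1 | h1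
  · left
    have : δ * γ₀⁻¹ = 1 := by
      have h2 := congrArg (fun x ↦ (g q)⁻¹ * x * g q) h1
      simpa [mul_assoc] using h2
    rw [mul_inv_eq_one] at this
    exact this
  · right
    have : δ * γ₀⁻¹ = -1 := by
      have h2 := congrArg (fun x ↦ (g q)⁻¹ * x * g q) h1
      simpa [mul_assoc] using h2
    rw [mul_inv_eq_iff_eq_mul, neg_one_mul] at this
    exact this

include hg in
/-- **Almost every point of `ℍ` has exactly two `Γ₀(N)`-translates in `F = ⋃_q g_q⁻¹ 𝒟ᵒ`**
(namely `±γ₀ ρ`): the measure-theoretic statement that `F` is a fundamental domain for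
`Γ₀(N)/{±1}` (Diamond–Shurman §5.4, p. 182; off the null set of points with an
`SL(2, ℤ)`-translate on `𝒟 ∖ 𝒟ᵒ`). [folklore] -/
theorem tsum_indicator_domain_smul_ae :
    ∀ᵐ ρ : ℍ, ∑' δ : Gamma0 N,
      (⋃ q, {τ : ℍ | g q • τ ∈ 𝒟ᵒ}).indicator (fun _ ↦ (1 : ℝ≥0∞)) ((δ : SL(2, ℤ)) • ρ) = 2 := by
  haveI : Countable SL(2, ℤ) := countable_SL2Z
  rw [ae_iff]
  refine measure_mono_null (fun ρ hρ ↦ ?_) (volume_setOf_exists_smul_mem_fd_diff_fdo)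
  by_contra hnot
  apply hρ
  have hτ : ∀ s : SL(2, ℤ), s • ρ ∈ 𝒟 → s • ρ ∈ 𝒟ᵒ := by
    intro s hs
    by_contra h'
    exact hnot ⟨s, hs, h'⟩
  obtain ⟨γ₀, hγ₀, q, hq⟩ := exists_smul_mem_smul_fdo g hg hτ
  have hF : γ₀ • ρ ∈ ⋃ q, {τ : ℍ | g q • τ ∈ 𝒟ᵒ} := mem_iUnion.mpr ⟨q, hq⟩
  have hFneg : -γ₀ • ρ ∈ ⋃ q, {τ : ℍ | g q • τ ∈ 𝒟ᵒ} := by rwa [SL_neg_smul]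
  set a : Gamma0 N := ⟨γ₀, hγ₀⟩ with ha
  set b : Gamma0 N := ⟨-γ₀, by
    rw [← neg_one_mul]; exact (Gamma0 N).mul_mem (by simp [Gamma0_mem]) hγ₀⟩ with hb
  have hab : a ≠ b := fun h ↦ SL_ne_neg_self γ₀ (congrArg Subtype.val h)
  rw [tsum_eq_sum (s := {a, b}) fun δ hδ ↦ ?_, Finset.sum_pair hab]
  · simp only [ha, hb, indicator_of_mem hF, indicator_of_mem hFneg, one_add_one_eq_two]
  · rw [indicator_of_notMem]
    intro hδF
    rcases eq_or_eq_neg_of_smul_mem_domain g hg hγ₀ δ.2 hF hδF with h | h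
    · exact hδ (by rw [Finset.mem_insert]; exact Or.inl (Subtype.ext h))
    · exact hδ (by rw [Finset.mem_insert, Finset.mem_singleton]; exact Or.inr (Subtype.ext h))

end Count

/-! ### The unfolding -/

section Unfolding

variable {N : ℕ}
variable (g : (↥𝒮ℒ ⧸ (Gamma0 N : Subgroup (GL (Fin 2) ℝ)).subgroupOf 𝒮ℒ) → SL(2, ℤ))
  (hg : ∀ q, (Matrix.SpecialLinearGroup.mapGL ℝ (g q) : GL (Fin 2) ℝ) = ((q.out : ↥𝒮ℒ) : GL (Fin 2) ℝ))
variable (γ : {v : Fin 2 → ℤ // IsCoprime (v 0) (v 1) ∧ (N : ℤ) ∣ v 0} → SL(2, ℤ))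
  (hγ : ∀ v, (γ v) 1 0 = v.1 0 ∧ (γ v) 1 1 = v.1 1)
variable [Fintype (↥𝒮ℒ ⧸ (Gamma0 N : Subgroup (GL (Fin 2) ℝ)).subgroupOf 𝒮ℒ)]

/-- The domain `F = ⋃_q g_q⁻¹ 𝒟ᵒ` is measurable (a finite union of open sets). [folklore] -/
theorem measurableSet_domain : MeasurableSet (⋃ q, {τ : ℍ | g q • τ ∈ 𝒟ᵒ}) :=
  MeasurableSet.iUnion fun q ↦ (isOpen_setOf_smul_mem_fdo (g q)).measurableSet



/-- The strips `{n ≤ Re σ < n + 1}`, `n ∈ ℤ`, cover `ℍ` (`n = ⌊Re σ⌋`). [folklore] -/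
theorem iUnion_strip_eq_univ :
    ⋃ n : ℤ, {σ : ℍ | (n : ℝ) ≤ σ.re ∧ σ.re < n + 1} = univ := by
  refine eq_univ_of_forall fun σ ↦ mem_iUnion.mpr ⟨⌊σ.re⌋, Int.floor_le _, Int.lt_floor_add_one _⟩

/-- The strips `{n ≤ Re σ < n + 1}` are pairwise disjoint. [folklore] -/
theorem pairwise_disjoint_strip :
    Pairwise (Disjoint on fun n : ℤ ↦ {σ : ℍ | (n : ℝ) ≤ σ.re ∧ σ.re < n + 1}) := by
  intro n m hnm
  simp only [Function.onFun, disjoint_left, mem_setOf_eq]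
  rintro σ ⟨h1, h2⟩ ⟨h3, h4⟩
  apply hnm
  have h5 : (n : ℝ) < m + 1 := h1.trans_lt h4
  have h6 : (m : ℝ) < n + 1 := h3.trans_lt h2
  have h7 : n < m + 1 := by exact_mod_cast h5
  have h8 : m < n + 1 := by exact_mod_cast h6
  omega

/-- The strips `{n ≤ Re σ < n + 1}` are measurable. [folklore] -/
theorem measurableSet_strip (n : ℤ) :
    MeasurableSet {σ : ℍ | (n : ℝ) ≤ σ.re ∧ σ.re < n + 1} :=
  (measurableSet_le measurable_const continuous_re.measurable).inter
    (measurableSet_lt continuous_re.measurable measurable_const)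

/-- `Tⁿ` maps the strip `{0 ≤ Re < 1}` onto `{n ≤ Re < n + 1}` (`Re Tⁿρ = Re ρ + n`). [folklore] -/
theorem preimage_T_zpow_strip (n : ℤ) :
    (fun ρ : ℍ ↦ T ^ n • ρ) ⁻¹' {σ : ℍ | (n : ℝ) ≤ σ.re ∧ σ.re < n + 1} =
      {ρ : ℍ | 0 ≤ ρ.re ∧ ρ.re < 1} := by
  ext ρ
  simp only [mem_preimage, mem_setOf_eq, re_T_zpow_smul]
  constructor
  · rintro ⟨h1, h2⟩; constructor <;> linarith
  · rintro ⟨h1, h2⟩; constructor <;> linarith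

include hg hγ in
/-- **Rankin–Selberg unfolding on `Γ₀(N)`** (in `ℝ≥0∞`, for a chosen section `v ↦ γ_v` of the
bottom-row map): for measurable `Γ₀(N)`-invariant `Φ ≥ 0` and measurable `w : ℝ → ℝ≥0∞`,
`∫⁻_F Φ(τ) Σ_{(c,d)=1, N∣c} w(Im γ_{(c,d)} τ) dμ = 2 ∫⁻_{0 ≤ Re < 1} Φ(ρ) w(Im ρ) dμ`, `F = ⋃_q g_q⁻¹ 𝒟ᵒ`
the tree's fundamental domain of `Γ₀(N)`. Steps: sum out (Tonelli); `σ = γ_v τ` (invariance of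
`dμ` and `Φ`); cut `ℍ` into `⨆ₙ Tⁿ{0 ≤ Re < 1}` and pull each strip back by `Tⁿ` (invariance of
`Φ` and of `Im`); re-index `Σ_v Σ_n 1_F(γ_v⁻¹ Tⁿ ρ) = Σ_{δ ∈ Γ₀(N)} 1_F(δ ρ)`
(`bijective_T_zpow_mul_rowSection`, inversion); the latter is `2` a.e.
(`tsum_indicator_domain_smul_ae`). (Rankin 1939; Selberg 1940; Iwaniec §3.2, (3.13).) [cite: Iwaniec2002, §3.2 (3.11)–(3.13) (Eisenstein series of a cusp and the unfolding), PDF pp. 42–43] -/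
theorem lintegral_domain_mul_tsum_eq [NeZero N] (Φ : ℍ → ℝ≥0∞) (hΦm : Measurable Φ)
    (hΦ : ∀ δ ∈ Gamma0 N, ∀ τ : ℍ, Φ (δ • τ) = Φ τ) (w : ℝ → ℝ≥0∞) (hw : Measurable w) :
    ∫⁻ τ in ⋃ q, {τ : ℍ | g q • τ ∈ 𝒟ᵒ}, Φ τ * ∑' v, w ((γ v • τ).im) =
      2 * ∫⁻ ρ in {ρ : ℍ | 0 ≤ ρ.re ∧ ρ.re < 1}, Φ ρ * w ρ.im := by
  haveI : Countable SL(2, ℤ) := countable_SL2Z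
  set F : Set ℍ := ⋃ q, {τ : ℍ | g q • τ ∈ 𝒟ᵒ} with hFdef
  set P : Set ℍ := {ρ : ℍ | 0 ≤ ρ.re ∧ ρ.re < 1} with hPdef
  have hF : MeasurableSet F := measurableSet_domain g
  have hP : MeasurableSet P :=
    (measurableSet_le measurable_const continuous_re.measurable).inter
      (measurableSet_lt continuous_re.measurable measurable_const)
  -- the `T`- and `Γ₀(N)`-invariant weight `h = Φ · w ∘ im`
  set h : ℍ → ℝ≥0∞ := fun σ ↦ Φ σ * w σ.im with hhdef
  have hhm : Measurable h := hΦm.mul (hw.comp continuous_im.measurable)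
  have hsm : ∀ s : SL(2, ℤ), Measurable fun τ : ℍ ↦ s • τ := fun s ↦ (continuous_sl2z_smul s).measurable
  have hind : ∀ s : SL(2, ℤ), Measurable fun σ : ℍ ↦ F.indicator (fun _ ↦ (1 : ℝ≥0∞)) (s • σ) :=
    fun s ↦ (measurable_const.indicator hF).comp (hsm s)
  -- Step 1: sum out
  have step1 : ∫⁻ τ in F, Φ τ * ∑' v, w ((γ v • τ).im) = ∑' v, ∫⁻ τ in F, Φ τ * w ((γ v • τ).im) := by
    simp_rw [← ENNReal.tsum_mul_left]
    exact lintegral_tsum fun v ↦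
      (hΦm.mul (hw.comp (continuous_im.measurable.comp (hsm _)))).aemeasurable
  -- Step 2: change of variables `σ = γ_v τ`
  have step2 : ∀ v, ∫⁻ τ in F, Φ τ * w ((γ v • τ).im) =
      ∫⁻ σ, F.indicator (fun _ ↦ (1 : ℝ≥0∞)) ((γ v)⁻¹ • σ) * h σ := by
    intro v
    have hinv : ∀ τ, Φ τ = Φ (γ v • τ) := fun τ ↦ (hΦ _ (rowSection_mem γ hγ v) τ).symm
    have e1 : ∫⁻ τ in F, Φ τ * w ((γ v • τ).im) =
        ∫⁻ τ, F.indicator (fun _ ↦ (1 : ℝ≥0∞)) ((γ v)⁻¹ • γ v • τ) * h (γ v • τ) := by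
      rw [← lintegral_indicator hF]
      refine lintegral_congr fun τ ↦ ?_
      rw [inv_smul_smul]
      by_cases hτ : τ ∈ F
      · rw [indicator_of_mem hτ, indicator_of_mem hτ, one_mul, hhdef]
        dsimp only
        rw [← hinv τ]
      · rw [indicator_of_notMem hτ, indicator_of_notMem hτ, zero_mul]
    rw [e1]
    exact (measurePreserving_smul (Matrix.SpecialLinearGroup.mapGL ℝ (γ v) : GL (Fin 2) ℝ)
      (volume : Measure ℍ)).lintegral_comp_emb
      (measurableEmbedding_const_smul (Matrix.SpecialLinearGroup.mapGL ℝ (γ v) : GL (Fin 2) ℝ))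
      (fun σ ↦ F.indicator (fun _ ↦ (1 : ℝ≥0∞)) ((γ v)⁻¹ • σ) * h σ)
  -- Step 3: cut `ℍ` into the strips `T^n P` and move each back to `P`
  have step3 : ∀ s : SL(2, ℤ), ∫⁻ σ, F.indicator (fun _ ↦ (1 : ℝ≥0∞)) (s • σ) * h σ =
      ∑' n : ℤ, ∫⁻ ρ in P, F.indicator (fun _ ↦ (1 : ℝ≥0∞)) (s • T ^ n • ρ) * h ρ := by
    intro s
    rw [← setLIntegral_univ, ← iUnion_strip_eq_univ, lintegral_iUnion measurableSet_strip
      pairwise_disjoint_strip]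
    refine tsum_congr fun n ↦ ?_
    rw [← (measurePreserving_smul (Matrix.SpecialLinearGroup.mapGL ℝ (T ^ n) : GL (Fin 2) ℝ)
      (volume : Measure ℍ)).setLIntegral_comp_preimage_emb
      (measurableEmbedding_const_smul (Matrix.SpecialLinearGroup.mapGL ℝ (T ^ n) : GL (Fin 2) ℝ))
      (fun σ ↦ F.indicator (fun _ ↦ (1 : ℝ≥0∞)) (s • σ) * h σ) {σ : ℍ | (n : ℝ) ≤ σ.re ∧ σ.re < n + 1}]
    change ∫⁻ ρ in (fun ρ : ℍ ↦ T ^ n • ρ) ⁻¹' {σ : ℍ | (n : ℝ) ≤ σ.re ∧ σ.re < n + 1},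
      F.indicator (fun _ ↦ (1 : ℝ≥0∞)) (s • T ^ n • ρ) * h (T ^ n • ρ) = _
    rw [preimage_T_zpow_strip n]
    refine setLIntegral_congr_fun hP fun ρ _ ↦ ?_
    rw [hhdef]
    dsimp only
    rw [hΦ _ (T_zpow_mem_Gamma0 N n) ρ, im_T_zpow_smul]
  -- Step 4: reassemble the sums inside the integral over `P`
  have hIm : ∀ (v) (n : ℤ), Measurable fun ρ : ℍ ↦
      F.indicator (fun _ ↦ (1 : ℝ≥0∞)) ((γ v)⁻¹ • T ^ n • ρ) * h ρ :=
    fun v n ↦ ((measurable_const.indicator hF).comp ((hsm _).comp (hsm _))).mul hhm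
  have step4 : ∑' v, ∑' n : ℤ, ∫⁻ ρ in P, F.indicator (fun _ ↦ (1 : ℝ≥0∞)) ((γ v)⁻¹ • T ^ n • ρ) * h ρ =
      ∫⁻ ρ in P, (∑' v, ∑' n : ℤ, F.indicator (fun _ ↦ (1 : ℝ≥0∞)) ((γ v)⁻¹ • T ^ n • ρ)) * h ρ := by
    symm
    calc ∫⁻ ρ in P, (∑' v, ∑' n : ℤ, F.indicator (fun _ ↦ (1 : ℝ≥0∞)) ((γ v)⁻¹ • T ^ n • ρ)) * h ρ
        = ∫⁻ ρ in P, ∑' v, ∑' n : ℤ, F.indicator (fun _ ↦ (1 : ℝ≥0∞)) ((γ v)⁻¹ • T ^ n • ρ) * h ρ := by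
          refine lintegral_congr fun ρ ↦ ?_
          rw [← ENNReal.tsum_mul_right]
          exact tsum_congr fun v ↦ by rw [← ENNReal.tsum_mul_right]
      _ = ∑' v, ∫⁻ ρ in P, ∑' n : ℤ, F.indicator (fun _ ↦ (1 : ℝ≥0∞)) ((γ v)⁻¹ • T ^ n • ρ) * h ρ :=
          lintegral_tsum fun v ↦ (Measurable.tsum fun n ↦ hIm v n).aemeasurable
      _ = ∑' v, ∑' n : ℤ, ∫⁻ ρ in P, F.indicator (fun _ ↦ (1 : ℝ≥0∞)) ((γ v)⁻¹ • T ^ n • ρ) * h ρ :=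
          tsum_congr fun v ↦ lintegral_tsum fun n ↦ (hIm v n).aemeasurable
  -- Step 5: the double sum is the sum over `Γ₀(N)`
  have step5 : ∀ ρ : ℍ, ∑' v, ∑' n : ℤ, F.indicator (fun _ ↦ (1 : ℝ≥0∞)) ((γ v)⁻¹ • T ^ n • ρ) =
      ∑' δ : Gamma0 N, F.indicator (fun _ ↦ (1 : ℝ≥0∞)) ((δ : SL(2, ℤ)) • ρ) := by
    intro ρ
    set e₁ := Equiv.ofBijective _ (bijective_T_zpow_mul_rowSection γ hγ) with he₁
    have e2 : ∑' δ : Gamma0 N, F.indicator (fun _ ↦ (1 : ℝ≥0∞)) ((δ : SL(2, ℤ)) • ρ) =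
        ∑' δ : Gamma0 N, F.indicator (fun _ ↦ (1 : ℝ≥0∞)) (((δ⁻¹ : Gamma0 N) : SL(2, ℤ)) • ρ) :=
      ((Equiv.inv (Gamma0 N)).tsum_eq
        (fun δ : Gamma0 N ↦ F.indicator (fun _ ↦ (1 : ℝ≥0∞)) ((δ : SL(2, ℤ)) • ρ))).symm
    have e3 : ∑' δ : Gamma0 N, F.indicator (fun _ ↦ (1 : ℝ≥0∞)) (((δ⁻¹ : Gamma0 N) : SL(2, ℤ)) • ρ) =
        ∑' p : ℤ × {v : Fin 2 → ℤ // IsCoprime (v 0) (v 1) ∧ (N : ℤ) ∣ v 0},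
          F.indicator (fun _ ↦ (1 : ℝ≥0∞)) ((T ^ p.1 * γ p.2)⁻¹ • ρ) := by
      rw [← e₁.tsum_eq]
      rfl
    rw [e2, e3]
    conv_rhs => rw [ENNReal.tsum_prod', ENNReal.tsum_comm]
    refine tsum_congr fun v ↦ ?_
    conv_rhs => rw [← (Equiv.neg ℤ).tsum_eq]
    refine tsum_congr fun n ↦ ?_
    simp only [Equiv.neg_apply, zpow_neg, mul_inv_rev, inv_inv, mul_smul]
  -- Step 6: which is `2` almost everywhere
  have step6 : ∫⁻ ρ in P, (∑' v, ∑' n : ℤ, F.indicator (fun _ ↦ (1 : ℝ≥0∞)) ((γ v)⁻¹ • T ^ n • ρ)) * h ρ =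
      ∫⁻ ρ in P, 2 * h ρ := by
    refine setLIntegral_congr_fun_ae hP ?_
    filter_upwards [tsum_indicator_domain_smul_ae g hg] with ρ hρ _
    rw [step5 ρ, hρ]
  -- assemble
  rw [step1]
  simp_rw [step2, step3]
  rw [step4, step6, lintegral_const_mul _ hhm]

omit [Fintype (↥𝒮ℒ ⧸ (Gamma0 N : Subgroup (GL (Fin 2) ℝ)).subgroupOf 𝒮ℒ)] in
include hγ in
/-- `Im (γ_v τ) = Im τ / |cτ + d|²` for the bottom row `v = (c, d)` (Mathlib
`ModularGroup.im_smul_eq_div_normSq`; Iwaniec (3.10)). [folklore] -/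
theorem im_rowSection_smul (v : {v : Fin 2 → ℤ // IsCoprime (v 0) (v 1) ∧ (N : ℤ) ∣ v 0}) (τ : ℍ) :
    (γ v • τ).im = τ.im / Complex.normSq ((v.1 0 : ℂ) * τ + v.1 1) := by
  rw [ModularGroup.im_smul_eq_div_normSq, ModularGroup.denom_apply, ← (hγ v).1, ← (hγ v).2]

include hg in
/-- **Rankin–Selberg unfolding on `Γ₀(N)`, Eisenstein form** (independent of any choice): for
measurable `Γ₀(N)`-invariant `Φ ≥ 0` on `ℍ` and measurable `w : ℝ → ℝ≥0∞`,
`∫⁻_F Φ(τ) · Σ_{(c,d)=1, N∣c} w(Im τ / |cτ + d|²) dμ(τ) = 2 ∫⁻_{0 ≤ Re ρ < 1} Φ(ρ) w(Im ρ) dμ(ρ)`,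
`F = ⋃_q g_q⁻¹ 𝒟ᵒ`; with `w(y) = yˢ` (`s > 1` real) the inner sum is `2 E_∞^{Γ₀(N)}(τ, s)`, the
Eisenstein series of the cusp `∞` of `Γ₀(N)`, and the right side is `2 ∫₀^∞∫₀¹ Φ yˢ dx dy/y²`
(Rankin 1939; Selberg 1940; Iwaniec §3.2 (3.11), (3.13)). [cite: Iwaniec2002, §3.2 (3.11)–(3.13), PDF pp. 42–43] -/
theorem lintegral_domain_mul_eisenstein_eq [NeZero N] (Φ : ℍ → ℝ≥0∞) (hΦm : Measurable Φ)
    (hΦ : ∀ δ ∈ Gamma0 N, ∀ τ : ℍ, Φ (δ • τ) = Φ τ) (w : ℝ → ℝ≥0∞) (hw : Measurable w) :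
    ∫⁻ τ in ⋃ q, {τ : ℍ | g q • τ ∈ 𝒟ᵒ}, Φ τ *
        ∑' v : {v : Fin 2 → ℤ // IsCoprime (v 0) (v 1) ∧ (N : ℤ) ∣ v 0},
          w (τ.im / Complex.normSq ((v.1 0 : ℂ) * τ + v.1 1)) =
      2 * ∫⁻ ρ in {ρ : ℍ | 0 ≤ ρ.re ∧ ρ.re < 1}, Φ ρ * w ρ.im := by
  obtain ⟨γ, hγ⟩ := exists_rowSection N
  have h := lintegral_domain_mul_tsum_eq g hg γ hγ Φ hΦm hΦ w hw
  simp_rw [im_rowSection_smul γ hγ] at h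
  exact h

end Unfolding

end Literature.NumberTheory.EllipticCurves.ModularForms

end
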